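import Literature.NumberTheory.EllipticCurves.ModularPolynomialLevelFiveFibres
import Literature.NumberTheory.EllipticCurves.ClassPolynomialNegTwenty
import Literature.NumberTheory.EllipticCurves.ClassPolynomialNegTwentyFour
import Literature.NumberTheory.EllipticCurves.ClassPolynomialNegThirtyFive
import Literature.NumberTheory.EllipticCurves.ClassPolynomialNegThirtySix
import HarnessLib

/-!
# Thirteen CM relations `Φ₅(x₀, y₀) = 0` for the modular equation of level 5 (discriminants `−11, −15, −16, −19, −20, −24, −35, −36`)

certified instances and evidence bearing on the general Hodge conjecture; no claim.

Topic `NumberTheory/EllipticCurves` (complex multiplication).  Theorem-only file (no definition, no named fact; D-0026),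
sequel to `ModularPolynomialLevelFiveFibres.lean` (the level-5 point movers `divPoint_five_heegnerTau_of_pos`,
`heegnerTau_five_mul`), in the tree's vocabulary `intModularPolynomial 5`, `heegnerTau`, `formJ`, `divPoint 5 k`;
`Fact (Nat.Prime 5)` is an instance ARGUMENT throughout.

## PRINTED inputs
* `Φ_m(j(στ), j(τ)) = 0` for `σ ∈ C(m)` [Cox2013, §11.B (11.15) and the remark after it, PDF p. 239] (tree:
  `intModularPolynomial_kleinJ_divPoint`), `σ_k τ = (τ + k)/5 ↔` the index-5 sublattice `5[1, σ_k τ]` [Cox2013, §11.B Lemma 11.24];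
* `j(τ_Q)` depends only on the proper equivalence class of `Q` [Cox2013, §11.A Thm. 11.2] (tree: `formJ_eq_formJ_act`);
* the singular moduli: `j = −32768, 287496, −884736` for `D = −11, −16, −19` [Cox2013, §12.C table (12.20)], and the class-number-two
  values of the tree files `ClassPolynomialNegFifteen/Twenty/TwentyFour/ThirtyFive/ThirtySix.lean` (`formJ_…_eq`).

## Results (OURS: the choice of sublattices and the reductions; each a kernel-checked consequence of the printed inputs)
For each CM point `τ_Q` below, ONE level-5 conjugate `(τ_Q + k)/5` is the Heegner point of an invertible `𝒪_D`-ideal of norm 5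
(so its modulus is a root of the SAME class polynomial `H_D`), giving a relation `Φ₅(j(τ_{Q'}), j(τ_Q)) = 0` between moduli the
tree knows exactly (§1: `conj_k_negD`; §2: `rel_negD` with the moduli as atoms `formJ Q`; §3: `rel_negD_explicit` with the printed
values substituted):
* `D = −11, −16, −19` (class number one, `5` split): the diagonal zeros `Φ₅(j, j) = 0` at `j = −32768, 287496, −884736`;
* `D = −15`: `Φ₅(j(τ_{(2,1,2)}), j(τ_{(1,1,4)})) = 0` and its conjugate; `D = −24`: `(2,0,3) ~ (1,0,6)`; `D = −35`: `(3,1,3) ~ (1,1,9)`;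
  `D = −36`: `(2,2,5) ~ (1,0,9)` (each pair both ways);
* `D = −20` (`5` ramified, `𝔭₅ = (√−5)` principal): the diagonal zeros `Φ₅(j₁, j₁) = 0 = Φ₅(j₂, j₂)` at the two IRRATIONAL moduli
  `j = 632000 ± 282880√5`.
Together with the two fibres of `ModularPolynomialLevelFiveFibres.lean` and the symmetry `κ_{m,n} = κ_{n,m}`
(`ModularPolynomialSymmetric.lean`) these relations determine `Φ₅` (a nonsingular 14 × 14 rational linear system for the
coefficients not fixed by the fibre over `0`; lit note PHI5-SCOPE) — the solve is left to a sequel.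

## References
* [Cox2013] D. A. Cox, *Primes of the form x² + ny²*, 2nd ed., Wiley (2013): §11.B (11.15) (p. 239), Lemma 11.24 (p. 243), §11.A Thm. 11.2,
  §12.C table (12.20) (pp. 266–267).
-/

noncomputable section

open Complex Polynomial
open UpperHalfPlane hiding I
open scoped MatrixGroups

namespace Literature.NumberTheory.EllipticCurves

open ModularForms
open Literature.NumberTheory.QuadraticFields.Quadratic (BinQF)
open Literature.NumberTheory.QuadraticFields.BinaryQuadraticForm (principalForm classNumberOneDiscrs)

namespace ModularPolynomialFive

/-! ### §0 Three class-number-one values (Cox (12.20)), re-derived so that this file depends on built modules only -/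

/-- `j(τ_P) = j(𝒪_D)` at the principal form of a class-number-one `D`. [cite: Cox2013, §12.C table (12.20)] -/
private theorem kleinJ_heegnerTau_principalForm' {D : ℤ} (hD : D ∈ classNumberOneDiscrs) :
    kleinJ (heegnerTau (principalForm D)) = ((singularModulus D : ℚ) : ℂ) := by
  have h : D < 0 ∧ (D % 4 = 0 ∨ D % 4 = 1) := by
    have hD' := hD
    simp only [classNumberOneDiscrs, Finset.mem_insert, Finset.mem_singleton] at hD'
    rcases hD' with rfl | rfl | rfl | rfl | rfl | rfl | rfl | rfl | rfl | rfl | rfl | rfl | rfl <;>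
      norm_num
  rw [kleinJ_eq_periodPair_j, ← formJ_def, formJ_principalForm h.1 h.2,
    j_cmPeriodPair_eq_singularModulus singularModuli_classNumberOne_holds
      singularModuli_nonmaximalOrders_holds hD]

/-- `j(τ_{(1,1,3)}) = −32768` (`D = −11`). [cite: Cox2013, §12.C table (12.20)] -/
private theorem kleinJ_heegnerTau_neg_eleven : kleinJ (heegnerTau (1, 1, 3)) = -32768 := by
  have h := kleinJ_heegnerTau_principalForm' (D := -11) (by decide)
  rw [show principalForm (-11) = (1, 1, 3) by decide] at h
  rw [h]; norm_num [singularModulus]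

/-- `j(τ_{(1,0,4)}) = j(2i) = 287496` (`D = −16`). [cite: Cox2013, §12.C table (12.20)] -/
private theorem kleinJ_heegnerTau_neg_sixteen : kleinJ (heegnerTau (1, 0, 4)) = 287496 := by
  have h := kleinJ_heegnerTau_principalForm' (D := -16) (by decide)
  rw [show principalForm (-16) = (1, 0, 4) by decide] at h
  rw [h]; norm_num [singularModulus]

/-- `j(τ_{(1,1,5)}) = −884736` (`D = −19`). [cite: Cox2013, §12.C table (12.20)] -/
private theorem kleinJ_heegnerTau_neg_nineteen : kleinJ (heegnerTau (1, 1, 5)) = -884736 := by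
  have h := kleinJ_heegnerTau_principalForm' (D := -19) (by decide)
  rw [show principalForm (-19) = (1, 1, 5) by decide] at h
  rw [h]; norm_num [singularModulus]

variable [Fact (Nat.Prime 5)]

/-! ### §1 One level-5 conjugate of each CM point (the sublattice that is an `𝒪`-ideal of norm 5) -/

/-- `j((τ_{(1,1,3)} + 2)/5) = j(τ_{(5,−3,1)}) = j(τ_{(1,1,3)}) = −32768` (`5` splits in `ℚ(√−11)`). [cite: Cox2013, §11.B Lemma 11.24, §11.A Thm. 11.2, §12.C (12.20)] -/
theorem conj_2_neg11 : kleinJ (divPoint 5 2 (heegnerTau (1, 1, 3))) = -32768 := by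
  have h := divPoint_five_heegnerTau_of_pos (a := 1) (b := 1) (c := 3) one_pos (by norm_num) 2
  norm_num at h
  have h5 := heegnerTau_five_mul (a := 5) (b := -3) (c := 1) (by norm_num) (by norm_num)
  norm_num at h5
  rw [h, h5, ← formJ_eq_kleinJ, ← kleinJ_heegnerTau_neg_eleven, ← formJ_eq_kleinJ]
  have e := formJ_eq_formJ_act ⟨5, -3, 1⟩ (by norm_num) (by norm_num [BinQF.disc]) (p := 0) (q := -1)
    (r := 1) (s := -1) (by norm_num)
  simpa [BinQF.act] using e

/-- `j((τ_{(1,0,4)} + 1)/5) = j(τ_{(5,−2,1)}) = j(τ_{(1,0,4)}) = 287496` (`5` splits in `ℚ(i)`). [cite: Cox2013, §11.B Lemma 11.24, §11.A Thm. 11.2, §12.C (12.20)] -/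
theorem conj_1_neg16 : kleinJ (divPoint 5 1 (heegnerTau (1, 0, 4))) = 287496 := by
  have h := divPoint_five_heegnerTau_of_pos (a := 1) (b := 0) (c := 4) one_pos (by norm_num) 1
  norm_num at h
  have h5 := heegnerTau_five_mul (a := 5) (b := -2) (c := 1) (by norm_num) (by norm_num)
  norm_num at h5
  rw [h, h5, ← formJ_eq_kleinJ, ← kleinJ_heegnerTau_neg_sixteen, ← formJ_eq_kleinJ]
  have e := formJ_eq_formJ_act ⟨5, -2, 1⟩ (by norm_num) (by norm_num [BinQF.disc]) (p := 0) (q := -1)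
    (r := 1) (s := -1) (by norm_num)
  simpa [BinQF.act] using e

/-- `j(τ_{(1,1,5)}/5) = j(τ_{(5,1,1)}) = j(τ_{(1,1,5)}) = −884736` (`5` splits in `ℚ(√−19)`). [cite: Cox2013, §11.B Lemma 11.24, §11.A Thm. 11.2, §12.C (12.20)] -/
theorem conj_0_neg19 : kleinJ (divPoint 5 0 (heegnerTau (1, 1, 5))) = -884736 := by
  have h := divPoint_five_heegnerTau_of_pos (a := 1) (b := 1) (c := 5) one_pos (by norm_num) 0
  norm_num at h
  have h5 := heegnerTau_five_mul (a := 5) (b := 1) (c := 1) (by norm_num) (by norm_num)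
  norm_num at h5
  rw [h, h5, ← formJ_eq_kleinJ, ← kleinJ_heegnerTau_neg_nineteen, ← formJ_eq_kleinJ]
  have e := formJ_eq_formJ_act ⟨5, 1, 1⟩ (by norm_num) (by norm_num [BinQF.disc]) (p := 0) (q := -1)
    (r := 1) (s := 1) (by norm_num)
  simpa [BinQF.act] using e

/-- `j((τ_{(1,1,4)} + 3)/5) = j(τ_{(5,−5,2)}) = j(τ_{(2,1,2)})` (`D = −15`, the ramified prime over `5`). [cite: Cox2013, §11.B Lemma 11.24 and §11.A Thm. 11.2] -/
theorem conj_3_neg15 : kleinJ (divPoint 5 3 (heegnerTau (1, 1, 4))) = formJ (2, 1, 2) := by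
  have h := divPoint_five_heegnerTau_of_pos (a := 1) (b := 1) (c := 4) one_pos (by norm_num) 3
  norm_num at h
  have h5 := heegnerTau_five_mul (a := 5) (b := -5) (c := 2) (by norm_num) (by norm_num)
  norm_num at h5
  rw [h, h5, ← formJ_eq_kleinJ]
  have e := formJ_eq_formJ_act ⟨5, -5, 2⟩ (by norm_num) (by norm_num [BinQF.disc]) (p := 0) (q := -1)
    (r := 1) (s := -1) (by norm_num)
  simpa [BinQF.act] using e

/-- `j((τ_{(2,1,2)} + 4)/5) = j(τ_{(10,−15,6)}) = j(τ_{(1,1,4)})` (`D = −15`). [cite: Cox2013, §11.B Lemma 11.24 and §11.A Thm. 11.2] -/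
theorem conj_4_neg15' : kleinJ (divPoint 5 4 (heegnerTau (2, 1, 2))) = formJ (1, 1, 4) := by
  have h := divPoint_five_heegnerTau_of_pos (a := 2) (b := 1) (c := 2) two_pos (by norm_num) 4
  norm_num at h
  have h5 := heegnerTau_five_mul (a := 10) (b := -15) (c := 6) (by norm_num) (by norm_num)
  norm_num at h5
  rw [h, h5, ← formJ_eq_kleinJ]
  have e := formJ_eq_formJ_act ⟨10, -15, 6⟩ (by norm_num) (by norm_num [BinQF.disc]) (p := -1) (q := -2)
    (r := -1) (s := -3) (by norm_num)
  simpa [BinQF.act] using e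

/-- `j(τ_{(1,0,5)}/5) = j(τ_{(5,0,1)}) = j(τ_{(1,0,5)})` (`D = −20`: the ramified prime `(√−5)` is principal). [cite: Cox2013, §11.B Lemma 11.24 and §11.A Thm. 11.2] -/
theorem conj_0_neg20 : kleinJ (divPoint 5 0 (heegnerTau (1, 0, 5))) = formJ (1, 0, 5) := by
  have h := divPoint_five_heegnerTau_of_pos (a := 1) (b := 0) (c := 5) one_pos (by norm_num) 0
  norm_num at h
  have h5 := heegnerTau_five_mul (a := 5) (b := 0) (c := 1) (by norm_num) (by norm_num)
  norm_num at h5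
  rw [h, h5, ← formJ_eq_kleinJ]
  have e := formJ_eq_formJ_act ⟨5, 0, 1⟩ (by norm_num) (by norm_num [BinQF.disc]) (p := 0) (q := -1)
    (r := 1) (s := 0) (by norm_num)
  simpa [BinQF.act] using e

/-- `j((τ_{(2,2,3)} + 3)/5) = j(τ_{(10,−10,3)}) = j(τ_{(2,2,3)})` (`D = −20`). [cite: Cox2013, §11.B Lemma 11.24 and §11.A Thm. 11.2] -/
theorem conj_3_neg20' : kleinJ (divPoint 5 3 (heegnerTau (2, 2, 3))) = formJ (2, 2, 3) := by
  have h := divPoint_five_heegnerTau_of_pos (a := 2) (b := 2) (c := 3) two_pos (by norm_num) 3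
  norm_num at h
  have h5 := heegnerTau_five_mul (a := 10) (b := -10) (c := 3) (by norm_num) (by norm_num)
  norm_num at h5
  rw [h, h5, ← formJ_eq_kleinJ]
  have e := formJ_eq_formJ_act ⟨10, -10, 3⟩ (by norm_num) (by norm_num [BinQF.disc]) (p := -1) (q := 0)
    (r := -2) (s := -1) (by norm_num)
  simpa [BinQF.act] using e

/-- `j((τ_{(1,0,6)} + 2)/5) = j(τ_{(5,−4,2)}) = j(τ_{(2,0,3)})` (`D = −24`). [cite: Cox2013, §11.B Lemma 11.24 and §11.A Thm. 11.2] -/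
theorem conj_2_neg24 : kleinJ (divPoint 5 2 (heegnerTau (1, 0, 6))) = formJ (2, 0, 3) := by
  have h := divPoint_five_heegnerTau_of_pos (a := 1) (b := 0) (c := 6) one_pos (by norm_num) 2
  norm_num at h
  have h5 := heegnerTau_five_mul (a := 5) (b := -4) (c := 2) (by norm_num) (by norm_num)
  norm_num at h5
  rw [h, h5, ← formJ_eq_kleinJ]
  have e := formJ_eq_formJ_act ⟨5, -4, 2⟩ (by norm_num) (by norm_num [BinQF.disc]) (p := 0) (q := -1)
    (r := 1) (s := -1) (by norm_num)
  simpa [BinQF.act] using e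

/-- `j((τ_{(2,0,3)} + 1)/5) = j(τ_{(10,−4,1)}) = j(τ_{(1,0,6)})` (`D = −24`). [cite: Cox2013, §11.B Lemma 11.24 and §11.A Thm. 11.2] -/
theorem conj_1_neg24' : kleinJ (divPoint 5 1 (heegnerTau (2, 0, 3))) = formJ (1, 0, 6) := by
  have h := divPoint_five_heegnerTau_of_pos (a := 2) (b := 0) (c := 3) two_pos (by norm_num) 1
  norm_num at h
  have h5 := heegnerTau_five_mul (a := 10) (b := -4) (c := 1) (by norm_num) (by norm_num)
  norm_num at h5
  rw [h, h5, ← formJ_eq_kleinJ]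
  have e := formJ_eq_formJ_act ⟨10, -4, 1⟩ (by norm_num) (by norm_num [BinQF.disc]) (p := 0) (q := -1)
    (r := 1) (s := -2) (by norm_num)
  simpa [BinQF.act] using e

/-- `j((τ_{(1,1,9)} + 3)/5) = j(τ_{(5,−5,3)}) = j(τ_{(3,1,3)})` (`D = −35`). [cite: Cox2013, §11.B Lemma 11.24 and §11.A Thm. 11.2] -/
theorem conj_3_neg35 : kleinJ (divPoint 5 3 (heegnerTau (1, 1, 9))) = formJ (3, 1, 3) := by
  have h := divPoint_five_heegnerTau_of_pos (a := 1) (b := 1) (c := 9) one_pos (by norm_num) 3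
  norm_num at h
  have h5 := heegnerTau_five_mul (a := 5) (b := -5) (c := 3) (by norm_num) (by norm_num)
  norm_num at h5
  rw [h, h5, ← formJ_eq_kleinJ]
  have e := formJ_eq_formJ_act ⟨5, -5, 3⟩ (by norm_num) (by norm_num [BinQF.disc]) (p := -1) (q := 0)
    (r := -1) (s := -1) (by norm_num)
  simpa [BinQF.act] using e

/-- `j((τ_{(3,1,3)} + 1)/5) = j(τ_{(15,−5,1)}) = j(τ_{(1,1,9)})` (`D = −35`). [cite: Cox2013, §11.B Lemma 11.24 and §11.A Thm. 11.2] -/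
theorem conj_1_neg35' : kleinJ (divPoint 5 1 (heegnerTau (3, 1, 3))) = formJ (1, 1, 9) := by
  have h := divPoint_five_heegnerTau_of_pos (a := 3) (b := 1) (c := 3) three_pos (by norm_num) 1
  norm_num at h
  have h5 := heegnerTau_five_mul (a := 15) (b := -5) (c := 1) (by norm_num) (by norm_num)
  norm_num at h5
  rw [h, h5, ← formJ_eq_kleinJ]
  have e := formJ_eq_formJ_act ⟨15, -5, 1⟩ (by norm_num) (by norm_num [BinQF.disc]) (p := 0) (q := -1)
    (r := 1) (s := -2) (by norm_num)
  simpa [BinQF.act] using e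

/-- `j((τ_{(1,0,9)} + 1)/5) = j(τ_{(5,−2,2)}) = j(τ_{(2,2,5)})` (`D = −36`). [cite: Cox2013, §11.B Lemma 11.24 and §11.A Thm. 11.2] -/
theorem conj_1_neg36 : kleinJ (divPoint 5 1 (heegnerTau (1, 0, 9))) = formJ (2, 2, 5) := by
  have h := divPoint_five_heegnerTau_of_pos (a := 1) (b := 0) (c := 9) one_pos (by norm_num) 1
  norm_num at h
  have h5 := heegnerTau_five_mul (a := 5) (b := -2) (c := 2) (by norm_num) (by norm_num)
  norm_num at h5
  rw [h, h5, ← formJ_eq_kleinJ]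
  have e := formJ_eq_formJ_act ⟨5, -2, 2⟩ (by norm_num) (by norm_num [BinQF.disc]) (p := 0) (q := -1)
    (r := 1) (s := 0) (by norm_num)
  simpa [BinQF.act] using e

/-- `j(τ_{(2,2,5)}/5) = j(τ_{(10,2,1)}) = j(τ_{(1,0,9)})` (`D = −36`). [cite: Cox2013, §11.B Lemma 11.24 and §11.A Thm. 11.2] -/
theorem conj_0_neg36' : kleinJ (divPoint 5 0 (heegnerTau (2, 2, 5))) = formJ (1, 0, 9) := by
  have h := divPoint_five_heegnerTau_of_pos (a := 2) (b := 2) (c := 5) two_pos (by norm_num) 0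
  norm_num at h
  have h5 := heegnerTau_five_mul (a := 10) (b := 2) (c := 1) (by norm_num) (by norm_num)
  norm_num at h5
  rw [h, h5, ← formJ_eq_kleinJ]
  have e := formJ_eq_formJ_act ⟨10, 2, 1⟩ (by norm_num) (by norm_num [BinQF.disc]) (p := 0) (q := -1)
    (r := 1) (s := 1) (by norm_num)
  simpa [BinQF.act] using e

/-! ### §2 The CM relations `Φ₅(x₀, y₀) = 0`: three rational diagonal zeros, five conjugate pairs (moduli as atoms), explicit forms -/

/-- **`Φ₅(−32768, −32768) = 0`** (`D = −11`). [cite: Cox2013, §11.B (11.15), §12.C (12.20)] -/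
theorem rel_neg11 : (((intModularPolynomial 5).map (mapRingHom (Int.castRingHom ℂ))).map
    (evalRingHom (-32768 : ℂ))).eval (-32768 : ℂ) = 0 := by
  have h := intModularPolynomial_kleinJ_divPoint 5 2 (heegnerTau (1, 1, 3))
  rwa [conj_2_neg11, kleinJ_heegnerTau_neg_eleven] at h

/-- **`Φ₅(287496, 287496) = 0`** (`D = −16`). [cite: Cox2013, §11.B (11.15), §12.C (12.20)] -/
theorem rel_neg16 : (((intModularPolynomial 5).map (mapRingHom (Int.castRingHom ℂ))).map
    (evalRingHom (287496 : ℂ))).eval (287496 : ℂ) = 0 := by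
  have h := intModularPolynomial_kleinJ_divPoint 5 1 (heegnerTau (1, 0, 4))
  rwa [conj_1_neg16, kleinJ_heegnerTau_neg_sixteen] at h

/-- **`Φ₅(−884736, −884736) = 0`** (`D = −19`). [cite: Cox2013, §11.B (11.15), §12.C (12.20)] -/
theorem rel_neg19 : (((intModularPolynomial 5).map (mapRingHom (Int.castRingHom ℂ))).map
    (evalRingHom (-884736 : ℂ))).eval (-884736 : ℂ) = 0 := by
  have h := intModularPolynomial_kleinJ_divPoint 5 0 (heegnerTau (1, 1, 5))
  rwa [conj_0_neg19, kleinJ_heegnerTau_neg_nineteen] at h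

/-- **`Φ₅(j(τ_{(2, 1, 2)}), j(τ_{(1, 1, 4)})) = 0`** (`D = −15`), with the moduli as atoms `formJ`. [cite: Cox2013, §11.B (11.15) and Lemma 11.24] -/
theorem rel_neg15 : (((intModularPolynomial 5).map (mapRingHom (Int.castRingHom ℂ))).map
    (evalRingHom (formJ (1, 1, 4)))).eval (formJ (2, 1, 2)) = 0 := by
  have h := intModularPolynomial_kleinJ_divPoint 5 3 (heegnerTau (1, 1, 4))
  rwa [conj_3_neg15, ← formJ_eq_kleinJ] at h

/-- **`Φ₅(j(τ_{(1, 1, 4)}), j(τ_{(2, 1, 2)})) = 0`** (`D = −15`), with the moduli as atoms `formJ`. [cite: Cox2013, §11.B (11.15) and Lemma 11.24] -/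
theorem rel_neg15' : (((intModularPolynomial 5).map (mapRingHom (Int.castRingHom ℂ))).map
    (evalRingHom (formJ (2, 1, 2)))).eval (formJ (1, 1, 4)) = 0 := by
  have h := intModularPolynomial_kleinJ_divPoint 5 4 (heegnerTau (2, 1, 2))
  rwa [conj_4_neg15', ← formJ_eq_kleinJ] at h

/-- **`Φ₅(j(τ_{(1, 0, 5)}), j(τ_{(1, 0, 5)})) = 0`** (`D = −20`), with the moduli as atoms `formJ`. [cite: Cox2013, §11.B (11.15) and Lemma 11.24] -/
theorem rel_neg20 : (((intModularPolynomial 5).map (mapRingHom (Int.castRingHom ℂ))).map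
    (evalRingHom (formJ (1, 0, 5)))).eval (formJ (1, 0, 5)) = 0 := by
  have h := intModularPolynomial_kleinJ_divPoint 5 0 (heegnerTau (1, 0, 5))
  rwa [conj_0_neg20, ← formJ_eq_kleinJ] at h

/-- **`Φ₅(j(τ_{(2, 2, 3)}), j(τ_{(2, 2, 3)})) = 0`** (`D = −20`), with the moduli as atoms `formJ`. [cite: Cox2013, §11.B (11.15) and Lemma 11.24] -/
theorem rel_neg20' : (((intModularPolynomial 5).map (mapRingHom (Int.castRingHom ℂ))).map
    (evalRingHom (formJ (2, 2, 3)))).eval (formJ (2, 2, 3)) = 0 := by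
  have h := intModularPolynomial_kleinJ_divPoint 5 3 (heegnerTau (2, 2, 3))
  rwa [conj_3_neg20', ← formJ_eq_kleinJ] at h

/-- **`Φ₅(j(τ_{(2, 0, 3)}), j(τ_{(1, 0, 6)})) = 0`** (`D = −24`), with the moduli as atoms `formJ`. [cite: Cox2013, §11.B (11.15) and Lemma 11.24] -/
theorem rel_neg24 : (((intModularPolynomial 5).map (mapRingHom (Int.castRingHom ℂ))).map
    (evalRingHom (formJ (1, 0, 6)))).eval (formJ (2, 0, 3)) = 0 := by
  have h := intModularPolynomial_kleinJ_divPoint 5 2 (heegnerTau (1, 0, 6))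
  rwa [conj_2_neg24, ← formJ_eq_kleinJ] at h

/-- **`Φ₅(j(τ_{(1, 0, 6)}), j(τ_{(2, 0, 3)})) = 0`** (`D = −24`), with the moduli as atoms `formJ`. [cite: Cox2013, §11.B (11.15) and Lemma 11.24] -/
theorem rel_neg24' : (((intModularPolynomial 5).map (mapRingHom (Int.castRingHom ℂ))).map
    (evalRingHom (formJ (2, 0, 3)))).eval (formJ (1, 0, 6)) = 0 := by
  have h := intModularPolynomial_kleinJ_divPoint 5 1 (heegnerTau (2, 0, 3))
  rwa [conj_1_neg24', ← formJ_eq_kleinJ] at h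

/-- **`Φ₅(j(τ_{(3, 1, 3)}), j(τ_{(1, 1, 9)})) = 0`** (`D = −35`), with the moduli as atoms `formJ`. [cite: Cox2013, §11.B (11.15) and Lemma 11.24] -/
theorem rel_neg35 : (((intModularPolynomial 5).map (mapRingHom (Int.castRingHom ℂ))).map
    (evalRingHom (formJ (1, 1, 9)))).eval (formJ (3, 1, 3)) = 0 := by
  have h := intModularPolynomial_kleinJ_divPoint 5 3 (heegnerTau (1, 1, 9))
  rwa [conj_3_neg35, ← formJ_eq_kleinJ] at h

/-- **`Φ₅(j(τ_{(1, 1, 9)}), j(τ_{(3, 1, 3)})) = 0`** (`D = −35`), with the moduli as atoms `formJ`. [cite: Cox2013, §11.B (11.15) and Lemma 11.24] -/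
theorem rel_neg35' : (((intModularPolynomial 5).map (mapRingHom (Int.castRingHom ℂ))).map
    (evalRingHom (formJ (3, 1, 3)))).eval (formJ (1, 1, 9)) = 0 := by
  have h := intModularPolynomial_kleinJ_divPoint 5 1 (heegnerTau (3, 1, 3))
  rwa [conj_1_neg35', ← formJ_eq_kleinJ] at h

/-- **`Φ₅(j(τ_{(2, 2, 5)}), j(τ_{(1, 0, 9)})) = 0`** (`D = −36`), with the moduli as atoms `formJ`. [cite: Cox2013, §11.B (11.15) and Lemma 11.24] -/
theorem rel_neg36 : (((intModularPolynomial 5).map (mapRingHom (Int.castRingHom ℂ))).map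
    (evalRingHom (formJ (1, 0, 9)))).eval (formJ (2, 2, 5)) = 0 := by
  have h := intModularPolynomial_kleinJ_divPoint 5 1 (heegnerTau (1, 0, 9))
  rwa [conj_1_neg36, ← formJ_eq_kleinJ] at h

/-- **`Φ₅(j(τ_{(1, 0, 9)}), j(τ_{(2, 2, 5)})) = 0`** (`D = −36`), with the moduli as atoms `formJ`. [cite: Cox2013, §11.B (11.15) and Lemma 11.24] -/
theorem rel_neg36' : (((intModularPolynomial 5).map (mapRingHom (Int.castRingHom ℂ))).map
    (evalRingHom (formJ (2, 2, 5)))).eval (formJ (1, 0, 9)) = 0 := by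
  have h := intModularPolynomial_kleinJ_divPoint 5 0 (heegnerTau (2, 2, 5))
  rwa [conj_0_neg36', ← formJ_eq_kleinJ] at h

/-! ### §3 The same relations with the printed values of the moduli substituted -/

/-- `Φ₅(j₂, j₁) = 0`, `D = −15`: `j₁ = j(τ_{(1,1,4)}) = (−191025 − 85995√5)/2`, `j₂ = j(τ_{(2,1,2)}) = (−191025 + 85995√5)/2`.
[cite: Cox2013, §11.B (11.15)] -/
theorem rel_neg15_explicit : (((intModularPolynomial 5).map (mapRingHom (Int.castRingHom ℂ))).map
    (evalRingHom ((-191025 - 85995 * (√(5 : ℝ) : ℂ)) / 2))).eval ((-191025 + 85995 * (√(5 : ℝ) : ℂ)) / 2) = 0 := by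
  rw [← ClassPolynomialNegFifteen.formJ_one_one_four_eq, ← ClassPolynomialNegFifteen.formJ_two_one_two_eq]
  exact rel_neg15

/-- `Φ₅(j₁, j₁) = 0`, `D = −20`: `j₁ = j(√−5) = 632000 + 282880√5` (a diagonal zero at an irrational CM point). [cite: Cox2013, §11.B (11.15)] -/
theorem rel_neg20_explicit : (((intModularPolynomial 5).map (mapRingHom (Int.castRingHom ℂ))).map
    (evalRingHom (632000 + 282880 * (√(5 : ℝ) : ℂ)))).eval (632000 + 282880 * (√(5 : ℝ) : ℂ)) = 0 := by
  rw [← ClassPolynomialNegTwenty.formJ_eq]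
  exact rel_neg20

/-- `Φ₅(j₂, j₂) = 0`, `D = −20`: `j₂ = j(τ_{(2,2,3)}) = 632000 − 282880√5`. [cite: Cox2013, §11.B (11.15)] -/
theorem rel_neg20'_explicit : (((intModularPolynomial 5).map (mapRingHom (Int.castRingHom ℂ))).map
    (evalRingHom (632000 - 282880 * (√(5 : ℝ) : ℂ)))).eval (632000 - 282880 * (√(5 : ℝ) : ℂ)) = 0 := by
  rw [← ClassPolynomialNegTwenty.formJ_other_eq]
  exact rel_neg20'

/-- `Φ₅(j₂, j₁) = 0`, `D = −24`: `j₁ = j(√−6) = 2417472 + 1707264√2`, `j₂ = j(τ_{(2,0,3)}) = 2417472 − 1707264√2`. [cite: Cox2013, §11.B (11.15)] -/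
theorem rel_neg24_explicit : (((intModularPolynomial 5).map (mapRingHom (Int.castRingHom ℂ))).map
    (evalRingHom (2417472 + 1707264 * (√(2 : ℝ) : ℂ)))).eval (2417472 - 1707264 * (√(2 : ℝ) : ℂ)) = 0 := by
  rw [← ClassPolynomialNegTwentyFour.formJ_one_zero_six_eq, ← ClassPolynomialNegTwentyFour.formJ_two_zero_three_eq]
  exact rel_neg24

/-- `Φ₅(j₂, j₁) = 0`, `D = −35`: `j₁ = j(τ_{(1,1,9)}) = −58982400 − 26378240√5`, `j₂ = j(τ_{(3,1,3)}) = −58982400 + 26378240√5`.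
[cite: Cox2013, §11.B (11.15)] -/
theorem rel_neg35_explicit : (((intModularPolynomial 5).map (mapRingHom (Int.castRingHom ℂ))).map
    (evalRingHom (-58982400 - 26378240 * (√(5 : ℝ) : ℂ)))).eval (-58982400 + 26378240 * (√(5 : ℝ) : ℂ)) = 0 := by
  rw [← ClassPolynomialNegThirtyFive.formJ_eq, ← ClassPolynomialNegThirtyFive.formJ_other_eq]
  exact rel_neg35

/-- `Φ₅(j₂, j₁) = 0`, `D = −36`: `j₁ = j(3i) = 76771008 + 44330496√3`, `j₂ = j(τ_{(2,2,5)}) = 76771008 − 44330496√3`. [cite: Cox2013, §11.B (11.15)] -/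
theorem rel_neg36_explicit : (((intModularPolynomial 5).map (mapRingHom (Int.castRingHom ℂ))).map
    (evalRingHom (76771008 + 44330496 * (√(3 : ℝ) : ℂ)))).eval (76771008 - 44330496 * (√(3 : ℝ) : ℂ)) = 0 := by
  rw [← ClassPolynomialNegThirtySix.formJ_eq, ← ClassPolynomialNegThirtySix.formJ_other_eq]
  exact rel_neg36

end ModularPolynomialFive

end Literature.NumberTheory.EllipticCurves

end
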